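import Summits.AtomisticToContinuum.Crystallization.Theorems.ChargedEnergyGap.Negative.BlocksBound
import Literature.MathematicalPhysics.StatisticalMechanics.PeriodicConfigurationSums
import Literature.MathematicalPhysics.StatisticalMechanics.LennardJonesClusters
import Literature.MathematicalPhysics.StatisticalMechanics.LennardJonesThermodynamicLimitProofs

/-!
# Line `vanishing-excess-truss-rigidity` (crux `CoarseGrains`, stmt-AtomisticToContinuum-9331): the trial-state bound

Stub `stub_trialBound` of the line skeleton: for every periodic configuration `Q` of `ℝ³` and
every `η > 0`, `E(N) ≤ N·(e(Q) + η)` for all `N ≥ N₀(Q, η)` (Lennard-Jones; Blanc–Lewin 2015,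
§2.1: finite blocks of a periodic configuration as trial states).

Proof.  The tree already contains both ingredients:

* `Blocks.exists_block_energy_le` / `limsup_div_le_energyPerParticle`
  (`Theorems/ChargedEnergyGap/Negative/BlocksBound.lean`): blocks `F + {Σ kᵢbᵢ : 0 ≤ kᵢ < K}`
  of `Q = F + G` are injective configurations of `#F·K³` points with energy
  `≤ #F K³ (e(Q) + ε)` for `K ≥ K₀(ε)` (tails of the absolutely summable lattice sums are small
  on average), whence `limsup E(N)/N ≤ e(Q)`, packaged as `le_energyPerParticle_of_tendsto`:
  if `E(N)/N → e` then `e ≤ e(Q)`;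
* `BlancLewin2015_8_holds` (`LennardJonesThermodynamicLimitProofs.lean`): the thermodynamic
  limit `e_∞ = lim E(N)/N` exists in `d = 3` (stability + subadditivity + Fekete).

Hence `E(N)/N → e_∞ ≤ e(Q)`, so `E(N)/N < e_∞ + η ≤ e(Q) + η` for all large `N`, which is the
claim after clearing the denominator.  All `[folklore]`.
-/

noncomputable section

namespace Summit.AtomisticToContinuum.Crystallization.Theorems.ExcessDecayLiouvilleCoarseGrains

open Literature.MathematicalPhysics.StatisticalMechanics
open Summit.AtomisticToContinuum.Crystallization.Theorems.ChargedEnergyGapNegative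
open Filter Topology

/-- **Trial-state upper bound** (stub `stub_trialBound` of line `vanishing-excess-truss-rigidity`,
crux `CoarseGrains`): for every periodic configuration `Q` of `ℝ³` and every `η > 0` there is
`N₀` such that `E(N) ≤ N·(e(Q) + η)` for all `N ≥ N₀` — the `∀ Q ∀ η` form of the trial-state
bound `limsup E(N)/N ≤ e(Q)` (finite blocks of `Q` as trial states, Blanc–Lewin 2015, §2.1),
combined with the existence of the thermodynamic limit `lim E(N)/N`. [folklore] -/
theorem stub_trialBound :
    ∀ (Q : PeriodicConfiguration 3) (η : ℝ), 0 < η → ∃ N₀ : ℕ, ∀ N : ℕ, N₀ ≤ N →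
      groundStateEnergy lennardJones 3 N ≤ (N : ℝ) * (Q.energyPerParticle lennardJones + η) := by
  intro Q η hη
  obtain ⟨e, -, htend, -⟩ := BlancLewin2015_8_holds 3 (by norm_num) (by norm_num)
  have heQ : e ≤ Q.energyPerParticle lennardJones := le_energyPerParticle_of_tendsto htend Q
  have hev : ∀ᶠ N : ℕ in atTop, groundStateEnergy lennardJones 3 N / N < e + η :=
    htend.eventually (gt_mem_nhds (by linarith))
  obtain ⟨N₀, hN₀⟩ := eventually_atTop.1 hev
  refine ⟨N₀ + 1, fun N hN => ?_⟩
  have hNpos : (0 : ℝ) < N := by exact_mod_cast (show 0 < N by omega)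
  have h := hN₀ N (by omega)
  rw [div_lt_iff₀ hNpos] at h
  have h2 : (e + η) * N ≤ (N : ℝ) * (Q.energyPerParticle lennardJones + η) := by
    rw [mul_comm]
    exact mul_le_mul_of_nonneg_left (by linarith) hNpos.le
  exact (h.le.trans h2)

end Summit.AtomisticToContinuum.Crystallization.Theorems.ExcessDecayLiouvilleCoarseGrains

end
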